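import Literature.NumberTheory.Automorphic.SmoothIndOpenCellHaarIntertwiner                      -- (O2) FILE A: the `W`-valued open-cell Haar intertwiner (generic)
import Literature.NumberTheory.Automorphic.SmoothIndOpenCellCoinvariants                         -- ★ (U) `finrank_le_of_forall_mem_iff_exists_toFun_one_eq_zero_normalizedInd` (`dim ℓ ≤ dim W`)
import Literature.NumberTheory.Automorphic.SmoothIndClosedCellNonzero                            -- ★ (L-q) `ParabolicTriple.exists_normalizedInd_toFun_one_eq` (sections with prescribed `f(1)`)
import Summits.HodgeConjecture.HodgeConjecture.Theorems.F0P3U3PrincipalSeriesOpenCellTorusChar   -- ★ (γ-W): `exists_weylElt_three`; ⇒ ★ T2 ∕ T3b ∕ (Supp) ∕ (L-ℓ) ∕ modulus files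
import Summits.HodgeConjecture.HodgeConjecture.Theorems.F0P3U3PrincipalSeriesJacquetClosedCell   -- ★ (C): `evalJacquet`, `evalJacquetKer`, `mem_evalJacquetKer_iff`
import HarnessLib

/-!
# The open-cell part of `r_B i_G(σ)` for `U(Φ₃)(L⁺_v)` is the Weyl twist `σ^{w₀}`, for ANY smooth finite-dimensional `σ` of the torus
# ((GL-jet) PORT of node N1, FILE B; [Casselman1995, Lemma 7.1.1 (a)] with vector-valued inducing data)

Summit `HodgeConjecture`, crux H413 (pub/hodgecm-mathlib F0∕P3; E1 row (O2) of CENSUS-R67 §8 — the one algebraic letter (GL-jet) of the K4′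
«PAYDOWN-(J)» road, LEAD T15-51∕T15-52).  THEOREMS ONLY (kernel lane, `--supports stmt-HodgeConjecture-24833`); no definition, no named fact, no `sorry`,
no instance, no notation.  ★ N1 `UnitaryGroup.U3PrincipalSeriesJacquetFiltration` and its bricks ((C), (U), (Supp), (L-q), (L-ℓ), (γ-W)) compute
`r_B i_G(χ)` for a CHARACTER `χ` of `T(L⁺_v)` (★ N1's `-- TODO(general form)`: the printed geometric lemma is for arbitrary smooth `σ`).  THIS FILE is
that general form at the CM datum, on top of the generic `W`-valued Haar intertwiner ★ FILE A `Literature/…/SmoothIndOpenCellHaarIntertwiner`: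
* §0 `weylModulusScalar_eq_one` — σ-FREE scalar `δ_B^{-1∕2}(t) · Δ_B(t) · δ_B^{1∕2}(w₀ t w₀⁻¹) = 1` on `T(L⁺_v)` (★ `rootDeltaChar_cmBorel_torus`,
  ★ `deltaChar_cmBorel_torus`, ★ T3b `unitModulusChar_torusEntry_zero_weylConj`; the character case folded it into ★ `weylScalar_eq` with `wχ`).
* §1 `evalJacquet_surjective` — GENERIC: `ev : r_P(i_P σ) → σ` (★ (C) `evalJacquet`) is SURJECTIVE when the inducing datum has open vector-fixers
  (★ (L-q)); so the closed-cell quotient `r ⧸ ℓ` IS `σ`.  §1b `openCellFunctional_jacquetMap_of_pointwise` — GENERIC naturality of a Haar functional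
  under ANY `G`-map `S : Ind τ → Ind τ′` lying over a continuous linear `U` POINTWISE (generalises ★ FILE A §5 from `Ind(u)`).
* §2 (`section CM`: `v`, `σ`, `w₀` of matrix `Φ₃`): `exists_openCellSection_sigma` (★ (L-ℓ) at `σ`) · `exists_openCellFunctional_bijective_cm`
  (FILE A's `Λ` at a Haar measure of `N(L⁺_v)` EXISTS and is BIJECTIVE `ℓ → W`: ★ (Supp), ★ (L-ℓ), ★ F1 + ★ (U)) · `openCellFunctional_normalizedJacquet_cm`
  (`Λ (r(t) x) = σ(w₀ t w₀⁻¹) (Λ x)`: FILE A §4 + ★ T2 + §0) · **`exists_openCell_linearEquiv_weylTwist`** — at a NON-SPLIT `v`, for ANY finite-dimensional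
  `σ` of `T(L⁺_v)` (normed `W`) whose inducing datum `σ∘proj ⊗ δ_B^{1∕2}` has open vector-fixers, and `ℓ ≤ r_B i_G(σ)` the classes of sections vanishing
  at `1`: **`e : ℓ ≃ W` with (i) `e (r(t) x) = σ(w₀ t w₀⁻¹) (e x)`** («`ℓ ≅ σ^{w₀}`», membership proofs ∀-bound) **and (ii) `e (r(S) x) = U (e x)` for every
  `G`-endomorphism `S` of `i_G(σ)` over a linear `U` pointwise** (the jet consumer (O1)'s `hθM`∕`hθE` binders, `U = E = (w ↦ (0, w.1))`).
* §3 `finrank_normalizedJacquet_eq_two_mul` — `r_B i_G(σ)` is finite-dimensional of dimension `2 · dim W` (§1 + §2, rank–nullity).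
NOT here (datum-free in `σ`): the (O1)-D line `(N₀⁺)^{w₀} = N₀⁻` and the open fixers of the jet datum.  ELABORATION NOTE: budgets `3.2∕6.4·10⁶` =
the class of ★ `F0P3U3PrincipalSeriesOpenCellTorusChar`; on this carrier `set`∕`obtain … rfl`-naming and `rw [LinearEquiv.ofBijective_apply]` hit the
`whnf` wall (measured) — hence operators written out, `e y = Λ y` by `rfl`, stepwise `have; obtain`, small-goal finishes.
HONEST LABEL: count-neutral helper; K4′ shrinks only when (O1)+(O2)+(O1)-D are ★ and its head closes (rule 25∕26); HC_CM is proved only modulo the printed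
citations until rung 0 closes; this file discharges no named fact by itself.
References: [Casselman1995] W. Casselman, *Introduction to the theory of admissible representations of `p`-adic reductive groups* (1995), §6.3,
L. 7.1.1 (a); [BernsteinZelevinsky1977] I. N. Bernstein, A. V. Zelevinsky, Ann. Sci. ÉNS 10 (1977), Geometrical Lemma 2.12, §5 (5.2), Cor. 2.13 (c);
[Rogawski1990] J. D. Rogawski, *Automorphic Representations of Unitary Groups in Three Variables* (1990), §12.2 p. 173.
-/

set_option autoImplicit false
set_option linter.dupNamespace false

noncomputable section

open MeasureTheory Measure
open scoped NNReal ENNReal MatrixGroups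
open Literature.NumberTheory.Automorphic Literature.NumberTheory.Automorphic.UnitaryGroup
open Summit.HodgeConjecture.HodgeConjecture.Cruxes.H413.F0P2oBorelTorusModulus
open _root_.NumberField _root_.IsDedekindDomain

namespace Summit.HodgeConjecture.HodgeConjecture.Cruxes.H413.F0P3U3PrincipalSeriesOpenCellSigmaTwist

variable (L : Type) [Field L] [NumberField L] [IsCMField L]

/-! ## §0 The σ-free modulus scalar on the torus: `δ_B^{-1∕2}(t) · Δ_B(t) · δ_B^{1∕2}(w₀ t w₀⁻¹) = 1` -/

set_option synthInstance.maxHeartbeats 400000 in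
set_option maxHeartbeats 3200000 in
/-- **`δ_B^{-1∕2}(t) · Δ_B(t) · δ_B^{1∕2}(w₀ t w₀⁻¹) = 1`** on the torus of `U(Φ₃)(L⁺_v)` (`w₀` of matrix `Φ₃`): with `a := ‖t₀₀‖`, `δ_B^{1∕2}(t) = a`
(★ `rootDeltaChar_cmBorel_torus`), `Δ_B(t) = a²` (★ `deltaChar_cmBorel_torus`), `δ_B^{1∕2}(w₀ t w₀⁻¹) = a⁻¹` (★ T3b); ★ `weylScalar_eq` without the `wχ` factor.
[cite: Casselman1995, Lemma 7.1.1 (a)] [cite: Rogawski1990, §12.2 p. 173] -/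
theorem weylModulusScalar_eq_one (v : HeightOneSpectrum (𝓞 ↥(maximalRealSubfield L)))
    (w₀ : ↥(unitaryGroupOfForm (conjLocal L (IsCMField.complexConj L) v) (cmLocalForm L 3 v)))
    (hw₀ : Units.val (w₀ : GL (Fin 3) (LocalRing L v)) = cmLocalForm L 3 v)
    (t : ↥(torusU (conjLocal L (IsCMField.complexConj L) v) (cmLocalForm L 3 v))) :
    haveI := locallyCompactSpace_cmBorelU L 3 v;
    (((rootDeltaChar (cmBorelTriple L 3 v).P (Subgroup.inclusion (cmBorelTriple L 3 v).M_le t))⁻¹ : ℂˣ) : ℂ) *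
          (((modularCharacter (⟨(t : ↥(unitaryGroupOfForm (conjLocal L (IsCMField.complexConj L) v) (cmLocalForm L 3 v))), torusU_le_borelU _ _ t.2⟩ :
            ↥(cmBorelTriple L 3 v).P) : ℝ≥0) : ℂ)) *
        (((rootDeltaChar (cmBorelTriple L 3 v).P ⟨w₀ * (t : ↥(unitaryGroupOfForm (conjLocal L (IsCMField.complexConj L) v) (cmLocalForm L 3 v))) * w₀⁻¹,
          weylConj_mem_cmBorel L v w₀ hw₀ t⟩ : ℂˣ) : ℂ)) = 1 := by
  haveI := locallyCompactSpace_cmBorelU L 3 v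
  letI : MeasurableSpace (LocalRing L v) := borel _
  haveI : BorelSpace (LocalRing L v) := ⟨rfl⟩
  set a : ℝ≥0 := unitModulusChar (LocalRing L v) (torusEntry (conjLocal L (IsCMField.complexConj L) v) (cmLocalForm L 3 v) 0 t) with ha
  have ha0 : (a : ℂ) ≠ 0 := by
    rw [ha]
    exact Complex.ofReal_ne_zero.2 (NNReal.coe_ne_zero.2 (distribHaarChar_pos).ne')
  -- `δ^{1/2}(t) = a`
  have h1 : (((rootDeltaChar (cmBorelTriple L 3 v).P (Subgroup.inclusion (cmBorelTriple L 3 v).M_le t)) : ℂˣ) : ℂ) = (a : ℂ) :=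
    rootDeltaChar_cmBorel_torus L v t
  -- `δ^{1/2}(ʷt) = a⁻¹`
  set wt : ↥(torusU (conjLocal L (IsCMField.complexConj L) v) (cmLocalForm L 3 v)) :=
    ⟨w₀ * (t : ↥(unitaryGroupOfForm (conjLocal L (IsCMField.complexConj L) v) (cmLocalForm L 3 v))) * w₀⁻¹, weylConj_mem_cmTorus L v w₀ hw₀ t⟩ with hwt
  have h2 : (((rootDeltaChar (cmBorelTriple L 3 v).P ⟨w₀ * (t : ↥(unitaryGroupOfForm (conjLocal L (IsCMField.complexConj L) v) (cmLocalForm L 3 v))) * w₀⁻¹,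
      weylConj_mem_cmBorel L v w₀ hw₀ t⟩ : ℂˣ) : ℂ)) = ((a : ℂ))⁻¹ := by
    have h := rootDeltaChar_cmBorel_torus L v wt
    have hent : unitModulusChar (LocalRing L v) (torusEntry (conjLocal L (IsCMField.complexConj L) v) (cmLocalForm L 3 v) 0 wt) = a⁻¹ :=
      unitModulusChar_torusEntry_zero_weylConj (conjLocal L (IsCMField.complexConj L) v) (conjLocal_conjLocal_cm L v)
        (continuous_conjLocal L (IsCMField.complexConj L) v) (cmLocalForm_eq_over L 3 v) w₀ hw₀ t
    rw [hent, NNReal.coe_inv, Complex.ofReal_inv] at h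
    exact h
  -- `Δ_B(t) = a²`
  have h3 : (((modularCharacter (⟨(t : ↥(unitaryGroupOfForm (conjLocal L (IsCMField.complexConj L) v) (cmLocalForm L 3 v))), torusU_le_borelU _ _ t.2⟩ :
      ↥(cmBorelTriple L 3 v).P) : ℝ≥0) : ℂ)) = (a : ℂ) ^ 2 := by
    have h := deltaChar_cmBorel_torus L v t
    rw [← coe_modularCharacter_cmBorel_eq_deltaChar] at h
    exact h
  rw [Units.val_inv_eq_inv_val, h1, h2, h3]
  field_simp

/-! ## §1 Generic: evaluation at `1` on `r_P(i_P σ)` is surjective when the inducing datum has open vector-fixers -/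

/-- **`ev : r_P(i_P σ) → σ` IS SURJECTIVE** (★ (C) `evalJacquet`, `ev [f] = f(1)`): every `w` fixed by the inducing datum on the trace `P ∩ K` of an
open `K` is `f(1)` for a section `f` (★ (L-q) `ParabolicTriple.exists_normalizedInd_toFun_one_eq`); so the closed-cell quotient `r ⧸ ℓ` IS `σ`.
[cite: Casselman1995, Lemma 7.1.1 (a) p. 67; §6.3] [cite: BernsteinZelevinsky1977, §2.12 Geometrical Lemma, Cor. 2.13 (c)] -/
theorem evalJacquet_surjective {G : Type*} [Group G] [TopologicalSpace G] [IsTopologicalGroup G] (t : ParabolicTriple G) [LocallyCompactSpace ↥t.P]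
    {W : Type*} [AddCommGroup W] [Module ℂ W] (σ : Representation ℂ ↥t.M W)
    (hδ : ∀ (n : G) (hn : n ∈ t.N), deltaChar t.P ⟨n, t.N_le hn⟩ = 1)
    (hσ : ∀ w : W, ∃ K : Subgroup G, IsOpen (K : Set G) ∧ ∀ p : ↥t.P, (p : G) ∈ K →
      Representation.twist (σ.comp t.proj) (rootDeltaChar t.P) p w = w) :
    Function.Surjective (F0P3U3PrincipalSeriesJacquetClosedCell.evalJacquet t σ hδ) := by
  intro w
  obtain ⟨K, hKo, hK⟩ := hσ w
  obtain ⟨f, -, hf1⟩ := t.exists_normalizedInd_toFun_one_eq σ hKo hK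
  exact ⟨Representation.Coinvariants.mk _ f, by rw [F0P3U3PrincipalSeriesJacquetClosedCell.evalJacquet_mk, hf1]⟩

/-! ## §1b Generic: naturality of an open-cell Haar functional under ANY `G`-map lying over a linear map pointwise -/

/-- **NATURALITY OF THE HAAR FUNCTIONAL, POINTWISE FORM** (generalises ★ FILE A `ParabolicTriple.openCellFunctional_jacquetMap_smoothIndMap` from `Ind(u)`
to ANY intertwining map `S : Ind τ → Ind τ′` lying over a continuous linear `U` pointwise, `(S F)(x) = U (F x)` — the shape the jet consumer binds):
`Λ′ (r(S) x) = U (Λ x)` (the cell function of `S F` is `U ∘` that of `F`; `U` commutes with the Bochner integral).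
[cite: BernsteinZelevinsky1977, §1.8 and Geometrical Lemma 2.12] [cite: Casselman1995, §6.3] -/
theorem openCellFunctional_jacquetMap_of_pointwise {G : Type*} [Group G] [TopologicalSpace G] [IsTopologicalGroup G] (t : ParabolicTriple G)
    {W : Type*} [NormedAddCommGroup W] [NormedSpace ℂ W] [CompleteSpace W] (τ : Representation ℂ ↥t.P W)
    {W' : Type*} [NormedAddCommGroup W'] [NormedSpace ℂ W'] [CompleteSpace W'] (τ' : Representation ℂ ↥t.P W')
    [MeasurableSpace ↥t.N] [BorelSpace ↥t.N] (μ : Measure ↥t.N) [IsFiniteMeasureOnCompacts μ] (w₀ : G)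
    (ℓ : Submodule ℂ (t.restrict (Representation.smoothIndRep t.P τ)).Coinvariants)
    (hℓ : ∀ x, x ∈ ℓ ↔ ∃ f : Representation.SmoothInd t.P τ,
      f.toFun 1 = 0 ∧ Representation.Coinvariants.mk (t.restrict (Representation.smoothIndRep t.P τ)) f = x)
    (ℓ' : Submodule ℂ (t.restrict (Representation.smoothIndRep t.P τ')).Coinvariants)
    (hℓ' : ∀ x, x ∈ ℓ' ↔ ∃ f : Representation.SmoothInd t.P τ',
      f.toFun 1 = 0 ∧ Representation.Coinvariants.mk (t.restrict (Representation.smoothIndRep t.P τ')) f = x)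
    (hcs : ∀ f : Representation.SmoothInd t.P τ, f.toFun 1 = 0 → HasCompactSupport fun n : ↥t.N => f.toFun (w₀ * n))
    (Λ : ↥ℓ →ₗ[ℂ] W)
    (hΛ : ∀ (f : Representation.SmoothInd t.P τ) (hf : f.toFun 1 = 0), Λ ⟨_, t.mk_mem_openCell τ ℓ hℓ hf⟩ = ∫ n, f.toFun (w₀ * n) ∂μ)
    (Λ' : ↥ℓ' →ₗ[ℂ] W')
    (hΛ' : ∀ (f : Representation.SmoothInd t.P τ') (hf : f.toFun 1 = 0), Λ' ⟨_, t.mk_mem_openCell τ' ℓ' hℓ' hf⟩ = ∫ n, f.toFun (w₀ * n) ∂μ)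
    (S : (Representation.smoothIndRep t.P τ).IntertwiningMap (Representation.smoothIndRep t.P τ')) (U : W →L[ℂ] W')
    (hS : ∀ (F : Representation.SmoothInd t.P τ) (x : G), (S F).toFun x = U (F.toFun x))
    {x : (t.restrict (Representation.smoothIndRep t.P τ)).Coinvariants} (hx : x ∈ ℓ) (hSx : Representation.jacquetMap t S x ∈ ℓ') :
    Λ' ⟨Representation.jacquetMap t S x, hSx⟩ = U (Λ ⟨x, hx⟩) := by
  obtain ⟨f, hf, rfl⟩ := (hℓ x).1 hx
  have h1 : (S f).toFun 1 = 0 := by rw [hS, hf, map_zero]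
  have hval : Λ' ⟨Representation.jacquetMap t S (Representation.Coinvariants.mk (t.restrict (Representation.smoothIndRep t.P τ)) f), hSx⟩ =
      ∫ n, (S f).toFun (w₀ * n) ∂μ :=
    (congrArg Λ' (Subtype.ext (Representation.jacquetMap_mk t S f))).trans (hΛ' _ h1)
  rw [hval, hΛ f hf]
  simp only [hS]
  exact U.integral_comp_comm (SmoothInd.integrable_cellFun t.P τ t.N.subtype w₀ μ continuous_subtype_val (hcs f hf))

/-! ## §2 The CM datum `G = U(Φ₃)(L⁺_v)`, `v` non-split: `ℓ ≅ σ^{w₀}`, naturally in `σ` -/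

section CM

variable (v : HeightOneSpectrum (𝓞 ↥(maximalRealSubfield L)))
  {W : Type*} [NormedAddCommGroup W] [NormedSpace ℂ W] [FiniteDimensional ℂ W]
  (σ : Representation ℂ ↥(cmBorelTriple L 3 v).M W)
  (w₀ : ↥(unitaryGroupOfForm (conjLocal L (IsCMField.complexConj L) v) (cmLocalForm L 3 v))) (hw₀ : Units.val (w₀ : GL (Fin 3) (LocalRing L v)) = cmLocalForm L 3 v)

include hw₀

omit [FiniteDimensional ℂ W] in
set_option synthInstance.maxHeartbeats 400000 in
set_option maxHeartbeats 3200000 in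
/-- **the standard open-cell section of `i_G(σ)` at the Weyl element, vector-valued** (★ (L-ℓ) `exists_openCellSection` at `N = 3` with the given `w₀`,
ANY `σ`, any vector `w` with an open fixer): `Φ(1) = 0`, cell function `1_K · w`, `K` non-empty compact open (extracted as ★ `exists_openCellSection_three`).
[cite: Casselman1995, §6.3] [cite: BernsteinZelevinsky1977, §5 (5.1)–(5.2)] -/
theorem exists_openCellSection_sigma {K'' : Subgroup ↥(unitaryGroupOfForm (conjLocal L (IsCMField.complexConj L) v) (cmLocalForm L 3 v))} (hK'' : IsOpen (K'' : Set ↥(unitaryGroupOfForm (conjLocal L (IsCMField.complexConj L) v) (cmLocalForm L 3 v)))) {w : W}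
    (hw : haveI := locallyCompactSpace_cmBorelU L 3 v
      ∀ b : ↥(cmBorelTriple L 3 v).P, (b : ↥(unitaryGroupOfForm (conjLocal L (IsCMField.complexConj L) v) (cmLocalForm L 3 v))) ∈ K'' → (Representation.twist (σ.comp (cmBorelTriple L 3 v).proj) (rootDeltaChar (cmBorelTriple L 3 v).P)) b w = w) :
    haveI := locallyCompactSpace_cmBorelU L 3 v;
    ∃ Φ : Representation.SmoothInd (cmBorelTriple L 3 v).P (Representation.twist (σ.comp (cmBorelTriple L 3 v).proj) (rootDeltaChar (cmBorelTriple L 3 v).P)),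
      Φ.toFun 1 = 0 ∧ ∃ K : Set ↥(cmBorelTriple L 3 v).N, IsOpen K ∧ IsCompact K ∧ K.Nonempty ∧
        ∀ n : ↥(cmBorelTriple L 3 v).N, Φ.toFun (w₀ * (n : ↥(unitaryGroupOfForm (conjLocal L (IsCMField.complexConj L) v) (cmLocalForm L 3 v)))) = K.indicator (fun _ => w) n := by
  haveI := locallyCompactSpace_cmBorelU L 3 v
  have hw₀' : Units.val (w₀ : GL (Fin 3) (LocalRing L v)) = (StdForm.antidiagonal 3).over (LocalRing L v) := by
    rw [hw₀, cmLocalForm_eq_over]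
  exact exists_openCellSection L (IsCMField.complexConj L) 3 v (cmLocalForm_eq_over L 3 v) (by norm_num) _ w₀ hw₀' hK'' (w := w) hw

set_option synthInstance.maxHeartbeats 400000 in
set_option maxHeartbeats 6400000 in
/-- **FILE A's Haar functional at the CM datum is a linear isomorphism `ℓ ≃ W`** (`v` NON-SPLIT; `μ` any Haar measure on `N(L⁺_v)`): a linear
`Λ : ℓ →ₗ[ℂ] W` with `Λ [f] = ∫_N f(w₀ n) dμ` for every section vanishing at `1`, BIJECTIVE (★ (Supp), ★ FILE A, `exists_openCellSection_sigma`, ★ F1 + ★ (U)).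
[cite: Casselman1995, Lemma 7.1.1 (a) and §6.3] [cite: BernsteinZelevinsky1977, Geometrical Lemma 2.12 and Thm. 5.2] -/
theorem exists_openCellFunctional_bijective_cm (hv : ∀ w : PlacesOver L v, IsCMField.complexConj L • w.1 = w.1)
    (hσ : haveI := locallyCompactSpace_cmBorelU L 3 v
      ∀ w : W, ∃ K : Subgroup ↥(unitaryGroupOfForm (conjLocal L (IsCMField.complexConj L) v) (cmLocalForm L 3 v)), IsOpen (K : Set ↥(unitaryGroupOfForm (conjLocal L (IsCMField.complexConj L) v) (cmLocalForm L 3 v))) ∧ ∀ b : ↥(cmBorelTriple L 3 v).P, (b : ↥(unitaryGroupOfForm (conjLocal L (IsCMField.complexConj L) v) (cmLocalForm L 3 v))) ∈ K → (Representation.twist (σ.comp (cmBorelTriple L 3 v).proj) (rootDeltaChar (cmBorelTriple L 3 v).P)) b w = w)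
    [MeasurableSpace ↥(cmBorelTriple L 3 v).N] [BorelSpace ↥(cmBorelTriple L 3 v).N] (μ : Measure ↥(cmBorelTriple L 3 v).N) [μ.IsHaarMeasure]
    (ℓ : haveI := locallyCompactSpace_cmBorelU L 3 v
      Submodule ℂ ((cmBorelTriple L 3 v).restrict (Representation.normalizedInd (cmBorelTriple L 3 v) σ)).Coinvariants)
    (hℓ : haveI := locallyCompactSpace_cmBorelU L 3 v
      ∀ x, x ∈ ℓ ↔ ∃ f : Representation.SmoothInd (cmBorelTriple L 3 v).P (Representation.twist (σ.comp (cmBorelTriple L 3 v).proj) (rootDeltaChar (cmBorelTriple L 3 v).P)),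
        f.toFun 1 = 0 ∧ Representation.Coinvariants.mk ((cmBorelTriple L 3 v).restrict (Representation.normalizedInd (cmBorelTriple L 3 v) σ)) f = x) :
    haveI := locallyCompactSpace_cmBorelU L 3 v;
    ∃ Λ : ↥ℓ →ₗ[ℂ] W,
      (∀ (f : Representation.SmoothInd (cmBorelTriple L 3 v).P (Representation.twist (σ.comp (cmBorelTriple L 3 v).proj) (rootDeltaChar (cmBorelTriple L 3 v).P))) (hf : f.toFun 1 = 0),
          Λ ⟨_, (cmBorelTriple L 3 v).mk_mem_openCell (Representation.twist (σ.comp (cmBorelTriple L 3 v).proj) (rootDeltaChar (cmBorelTriple L 3 v).P)) ℓ hℓ hf⟩ = ∫ n, f.toFun (w₀ * (n : ↥(unitaryGroupOfForm (conjLocal L (IsCMField.complexConj L) v) (cmLocalForm L 3 v)))) ∂μ) ∧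
        Function.Bijective Λ := by
  haveI := locallyCompactSpace_cmBorelU L 3 v
  haveI : LocallyCompactSpace ↥(unitaryGroupOfForm (conjLocal L (IsCMField.complexConj L) v) (cmLocalForm L 3 v)) := locallyCompactSpace_local (IsCMField.complexConj L) 3 _ v
  haveI : SecondCountableTopology ↥(unitaryGroupOfForm (conjLocal L (IsCMField.complexConj L) v) (cmLocalForm L 3 v)) := secondCountableTopology_local (IsCMField.complexConj L) 3 _ v
  have hNcl : IsClosed ((cmBorelTriple L 3 v).N : Set ↥(unitaryGroupOfForm (conjLocal L (IsCMField.complexConj L) v) (cmLocalForm L 3 v))) :=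
    (isClosed_upperUnitriangular (n := 3) (R := LocalRing L v)).preimage continuous_subtype_val
  haveI : LocallyCompactSpace ↥(cmBorelTriple L 3 v).N := hNcl.isClosedEmbedding_subtypeVal.locallyCompactSpace
  haveI : SecondCountableTopology ↥(cmBorelTriple L 3 v).N := TopologicalSpace.Subtype.secondCountableTopology _
  haveI : CompleteSpace W := FiniteDimensional.complete ℂ W
  have hN := isLimitOfCompactOpen_cmBorelTriple_N L 3 v
  haveI : μ.IsMulRightInvariant := hN.isMulRightInvariant μ
  -- (Supp) compact support of every cell function (★ `hasCompactSupport_cellFun_cmBorel_three`, any `τ`)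
  have hcs : ∀ f : Representation.SmoothInd (cmBorelTriple L 3 v).P (Representation.twist (σ.comp (cmBorelTriple L 3 v).proj) (rootDeltaChar (cmBorelTriple L 3 v).P)),
      f.toFun 1 = 0 → HasCompactSupport fun n : ↥(cmBorelTriple L 3 v).N => f.toFun (w₀ * (n : ↥(unitaryGroupOfForm (conjLocal L (IsCMField.complexConj L) v) (cmLocalForm L 3 v)))) :=
    fun f hf => hasCompactSupport_cellFun_cmBorel_three L v hv w₀ hw₀ _ f hf
  -- FILE A: the Haar functional `Λ` on `ℓ`
  have HΛ := (cmBorelTriple L 3 v).exists_openCellFunctional (Representation.twist (σ.comp (cmBorelTriple L 3 v).proj) (rootDeltaChar (cmBorelTriple L 3 v).P)) μ w₀ ℓ hℓ hN hcs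
  obtain ⟨Λ, hΛ⟩ := HΛ
  -- (L-ℓ) an open-cell section with indicator cell function `1_K · w` for EVERY `w`
  have hsec : ∀ w : W, ∃ Φ : Representation.SmoothInd (cmBorelTriple L 3 v).P (Representation.twist (σ.comp (cmBorelTriple L 3 v).proj) (rootDeltaChar (cmBorelTriple L 3 v).P)),
      Φ.toFun 1 = 0 ∧ ∃ K : Set ↥(cmBorelTriple L 3 v).N, IsOpen K ∧ IsCompact K ∧ K.Nonempty ∧
        ∀ n : ↥(cmBorelTriple L 3 v).N, Φ.toFun (w₀ * (n : ↥(unitaryGroupOfForm (conjLocal L (IsCMField.complexConj L) v) (cmLocalForm L 3 v)))) = K.indicator (fun _ => w) n := by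
    intro w
    have H := hσ w
    obtain ⟨K'', hK''o, hK''⟩ := H
    exact exists_openCellSection_sigma L v σ w₀ hw₀ hK''o hK''
  -- (U) `dim ℓ ≤ dim W` (★ F1 Bruhat decomposition at the given `w₀`; stepwise, the one-shot `obtain` is an `isDefEq` wall)
  have H0 := U3LocalBruhatDecomposition_holds L v
  have H1 := H0 hv
  obtain ⟨w₀', hw₀'val, -, hBruhat, -⟩ := H1
  have hww : w₀' = w₀ := Subtype.ext (Units.ext (hw₀'val.trans hw₀.symm))
  rw [hww] at hBruhat
  have HU := Representation.finrank_le_of_forall_mem_iff_exists_toFun_one_eq_zero_normalizedInd (cmBorelTriple L 3 v) σ w₀ hN hBruhat hcs ℓ hℓ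
  obtain ⟨hfin, hle⟩ := HU
  exact ⟨Λ, hΛ, (cmBorelTriple L 3 v).openCellFunctional_bijective (Representation.twist (σ.comp (cmBorelTriple L 3 v).proj) (rootDeltaChar (cmBorelTriple L 3 v).P)) μ w₀ ℓ hℓ Λ hΛ hfin hle hsec⟩

set_option synthInstance.maxHeartbeats 400000 in
set_option maxHeartbeats 6400000 in
/-- **THE TORUS ACTS ON THE OPEN-CELL PART THROUGH `σ^{w₀}` under any Haar functional `Λ`** (FILE A §4 at the CM datum + ★ T2 + §0):
`Λ (r(t) x) = σ(w₀ t w₀⁻¹) (Λ x)` for `t ∈ T(L⁺_v)`, `x ∈ ℓ` (membership proofs ∀-bound).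
[cite: Casselman1995, Lemma 7.1.1 (a) and §6.3] [cite: BernsteinZelevinsky1977, Geometrical Lemma 2.12 and §5 (5.2)] [cite: Rogawski1990, §12.2 p. 173] -/
theorem openCellFunctional_normalizedJacquet_cm (hv : ∀ w : PlacesOver L v, IsCMField.complexConj L • w.1 = w.1)
    [MeasurableSpace ↥(cmBorelTriple L 3 v).N] [BorelSpace ↥(cmBorelTriple L 3 v).N] (μ : Measure ↥(cmBorelTriple L 3 v).N) [μ.IsHaarMeasure]
    (ℓ : haveI := locallyCompactSpace_cmBorelU L 3 v
      Submodule ℂ ((cmBorelTriple L 3 v).restrict (Representation.normalizedInd (cmBorelTriple L 3 v) σ)).Coinvariants)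
    (hℓ : haveI := locallyCompactSpace_cmBorelU L 3 v
      ∀ x, x ∈ ℓ ↔ ∃ f : Representation.SmoothInd (cmBorelTriple L 3 v).P (Representation.twist (σ.comp (cmBorelTriple L 3 v).proj) (rootDeltaChar (cmBorelTriple L 3 v).P)),
        f.toFun 1 = 0 ∧ Representation.Coinvariants.mk ((cmBorelTriple L 3 v).restrict (Representation.normalizedInd (cmBorelTriple L 3 v) σ)) f = x)
    (Λ : ↥ℓ →ₗ[ℂ] W)
    (hΛ : haveI := locallyCompactSpace_cmBorelU L 3 v
      ∀ (f : Representation.SmoothInd (cmBorelTriple L 3 v).P (Representation.twist (σ.comp (cmBorelTriple L 3 v).proj) (rootDeltaChar (cmBorelTriple L 3 v).P))) (hf : f.toFun 1 = 0),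
        Λ ⟨_, (cmBorelTriple L 3 v).mk_mem_openCell (Representation.twist (σ.comp (cmBorelTriple L 3 v).proj) (rootDeltaChar (cmBorelTriple L 3 v).P)) ℓ hℓ hf⟩ = ∫ n, f.toFun (w₀ * (n : ↥(unitaryGroupOfForm (conjLocal L (IsCMField.complexConj L) v) (cmLocalForm L 3 v)))) ∂μ)
    (m : ↥(cmBorelTriple L 3 v).M)
    (x : haveI := locallyCompactSpace_cmBorelU L 3 v
      ((cmBorelTriple L 3 v).restrict (Representation.normalizedInd (cmBorelTriple L 3 v) σ)).Coinvariants) (hx : x ∈ ℓ)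
    (hmx : haveI := locallyCompactSpace_cmBorelU L 3 v
      (Representation.normalizedInd (cmBorelTriple L 3 v) σ).normalizedJacquet (cmBorelTriple L 3 v) m x ∈ ℓ) :
    haveI := locallyCompactSpace_cmBorelU L 3 v;
    Λ ⟨(Representation.normalizedInd (cmBorelTriple L 3 v) σ).normalizedJacquet (cmBorelTriple L 3 v) m x, hmx⟩ =
      σ ⟨w₀ * (m : ↥(unitaryGroupOfForm (conjLocal L (IsCMField.complexConj L) v) (cmLocalForm L 3 v))) * w₀⁻¹, weylConj_mem_cmTorus L v w₀ hw₀ m⟩ (Λ ⟨x, hx⟩) := by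
  haveI := locallyCompactSpace_cmBorelU L 3 v
  haveI : LocallyCompactSpace ↥(unitaryGroupOfForm (conjLocal L (IsCMField.complexConj L) v) (cmLocalForm L 3 v)) := locallyCompactSpace_local (IsCMField.complexConj L) 3 _ v
  haveI : SecondCountableTopology ↥(unitaryGroupOfForm (conjLocal L (IsCMField.complexConj L) v) (cmLocalForm L 3 v)) := secondCountableTopology_local (IsCMField.complexConj L) 3 _ v
  have hNcl : IsClosed ((cmBorelTriple L 3 v).N : Set ↥(unitaryGroupOfForm (conjLocal L (IsCMField.complexConj L) v) (cmLocalForm L 3 v))) :=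
    (isClosed_upperUnitriangular (n := 3) (R := LocalRing L v)).preimage continuous_subtype_val
  haveI : LocallyCompactSpace ↥(cmBorelTriple L 3 v).N := hNcl.isClosedEmbedding_subtypeVal.locallyCompactSpace
  haveI : SecondCountableTopology ↥(cmBorelTriple L 3 v).N := TopologicalSpace.Subtype.secondCountableTopology _
  haveI : CompleteSpace W := FiniteDimensional.complete ℂ W
  -- (Supp)
  have hcs : ∀ f : Representation.SmoothInd (cmBorelTriple L 3 v).P (Representation.twist (σ.comp (cmBorelTriple L 3 v).proj) (rootDeltaChar (cmBorelTriple L 3 v).P)),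
      f.toFun 1 = 0 → HasCompactSupport fun n : ↥(cmBorelTriple L 3 v).N => f.toFun (w₀ * (n : ↥(unitaryGroupOfForm (conjLocal L (IsCMField.complexConj L) v) (cmLocalForm L 3 v)))) :=
    fun f hf => hasCompactSupport_cellFun_cmBorel_three L v hv w₀ hw₀ _ f hf
  -- the torus data: `ʷm ∈ B`, `n m = m (m⁻¹ n m)`, `μ.map (m⁻¹ · m) = Δ_B(m) • μ`
  have hm := weylConj_mem_cmBorel L v w₀ hw₀ m
  have hc : ∀ n : ↥(cmBorelTriple L 3 v).N,
      (n : ↥(unitaryGroupOfForm (conjLocal L (IsCMField.complexConj L) v) (cmLocalForm L 3 v))) * (m : ↥(unitaryGroupOfForm (conjLocal L (IsCMField.complexConj L) v) (cmLocalForm L 3 v))) = (m : ↥(unitaryGroupOfForm (conjLocal L (IsCMField.complexConj L) v) (cmLocalForm L 3 v))) * (HeisRing.torusConj (conjLocal L (IsCMField.complexConj L) v) m n : ↥(unitaryGroupOfForm (conjLocal L (IsCMField.complexConj L) v) (cmLocalForm L 3 v))) := by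
    intro n
    rw [HeisRing.coe_torusConj, ← mul_assoc, ← mul_assoc, mul_inv_cancel, one_mul]
  have hμ := map_torusConj_cmBorel_eq_modularCharacter_nnreal_smul L v m μ
  -- `τ(ʷm) = δ^{1/2}(ʷm) • σ(ʷm)` as a continuous linear map
  -- `τ(ʷm) = δ^{1/2}(ʷm) • σ(ʷm)` as a continuous linear map, written out (see the ELABORATION NOTE)
  have hA : ∀ w : W, (Representation.twist (σ.comp (cmBorelTriple L 3 v).proj) (rootDeltaChar (cmBorelTriple L 3 v).P)) ⟨w₀ * (m : ↥(unitaryGroupOfForm (conjLocal L (IsCMField.complexConj L) v) (cmLocalForm L 3 v))) * w₀⁻¹, hm⟩ w =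
      ((((rootDeltaChar (cmBorelTriple L 3 v).P ⟨w₀ * (m : ↥(unitaryGroupOfForm (conjLocal L (IsCMField.complexConj L) v) (cmLocalForm L 3 v))) * w₀⁻¹, hm⟩ : ℂˣ) : ℂ)) •
        LinearMap.toContinuousLinearMap (σ ⟨w₀ * (m : ↥(unitaryGroupOfForm (conjLocal L (IsCMField.complexConj L) v) (cmLocalForm L 3 v))) * w₀⁻¹, weylConj_mem_cmTorus L v w₀ hw₀ m⟩)) w := by
    intro w
    rw [Representation.twist_apply, MonoidHom.comp_apply, proj_cmBorel_weylConj L v w₀ hw₀ m]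
    rfl
  have key := (cmBorelTriple L 3 v).openCellFunctional_normalizedJacquet (Representation.twist (σ.comp (cmBorelTriple L 3 v).proj) (rootDeltaChar (cmBorelTriple L 3 v).P)) μ w₀ ℓ hℓ Λ hΛ hcs m hm
    (HeisRing.torusConj (conjLocal L (IsCMField.complexConj L) v) m)
    (HeisRing.continuous_torusConj (conjLocal L (IsCMField.complexConj L) v) m).measurable hc hμ _ hA hx
  have hscal := weylModulusScalar_eq_one L v w₀ hw₀ m
  have hfin : ∀ y : W,
      ((((rootDeltaChar (cmBorelTriple L 3 v).P (Subgroup.inclusion (cmBorelTriple L 3 v).M_le m))⁻¹ : ℂˣ) : ℂ) * ((modularCharacter (⟨(m : ↥(unitaryGroupOfForm (conjLocal L (IsCMField.complexConj L) v) (cmLocalForm L 3 v))), torusU_le_borelU _ _ m.2⟩ : ↥(cmBorelTriple L 3 v).P) : ℝ≥0) : ℂ)) • ((((rootDeltaChar (cmBorelTriple L 3 v).P ⟨w₀ * (m : ↥(unitaryGroupOfForm (conjLocal L (IsCMField.complexConj L) v) (cmLocalForm L 3 v))) * w₀⁻¹, hm⟩ : ℂˣ) : ℂ) • LinearMap.toContinuousLinearMap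 (σ ⟨w₀ * (m : ↥(unitaryGroupOfForm (conjLocal L (IsCMField.complexConj L) v) (cmLocalForm L 3 v))) * w₀⁻¹, weylConj_mem_cmTorus L v w₀ hw₀ m⟩)) y) = σ ⟨w₀ * (m : ↥(unitaryGroupOfForm (conjLocal L (IsCMField.complexConj L) v) (cmLocalForm L 3 v))) * w₀⁻¹, weylConj_mem_cmTorus L v w₀ hw₀ m⟩ y := by
    intro y
    have h1 : (((rootDeltaChar (cmBorelTriple L 3 v).P ⟨w₀ * (m : ↥(unitaryGroupOfForm (conjLocal L (IsCMField.complexConj L) v) (cmLocalForm L 3 v))) * w₀⁻¹, hm⟩ : ℂˣ) : ℂ) • LinearMap.toContinuousLinearMap (σ ⟨w₀ * (m : ↥(unitaryGroupOfForm (conjLocal L (IsCMField.complexConj L) v) (cmLocalForm L 3 v))) * w₀⁻¹, weylConj_mem_cmTorus L v w₀ hw₀ m⟩)) y = ((rootDeltaChar (cmBorelTriple L 3 v).P ⟨w₀ * (m : ↥(unitaryGroupOfForm (conjLocal L (IsCMField.complexConj L) v) (cmLocalForm L 3 v))) * w₀⁻¹, hm⟩ : ℂˣ) : ℂ) • σ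 ⟨w₀ * (m : ↥(unitaryGroupOfForm (conjLocal L (IsCMField.complexConj L) v) (cmLocalForm L 3 v))) * w₀⁻¹, weylConj_mem_cmTorus L v w₀ hw₀ m⟩ y := rfl
    rw [h1, smul_smul, hscal, one_smul]
  exact key.trans (hfin _)

set_option synthInstance.maxHeartbeats 400000 in
set_option maxHeartbeats 6400000 in
/-- **THE OPEN-CELL PART OF `r_B i_G(σ)` IS THE WEYL TWIST `σ^{w₀}`, NATURALLY** ([Casselman1995, Lemma 7.1.1 (a)] «`0 → (w⁻¹σ)δ^{1∕2} → I_N → σδ^{1∕2} → 0`»,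
VECTOR-valued `σ`, open-orbit term, normalised form): `G = U(Φ₃)(L⁺_v)`, `v` NON-SPLIT, `w₀` of matrix `Φ₃`, `σ` ANY representation of `T(L⁺_v)` on a
finite-dimensional normed `W` whose inducing datum has open vector-fixers (`hσ`), `ℓ ≤ r_B i_G(σ)` the classes of sections vanishing at `1` (`hℓ`).  THEN
`∃ e : ℓ ≃ₗ[ℂ] W` with (i) `e (r(t) x) = σ(w₀ t w₀⁻¹) (e x)` (membership proofs ∀-bound) and (ii) `e (r(S) x) = U (e x)` for every `G`-endomorphism `S` of
`i_G(σ)` lying over a linear `U` pointwise (the jet consumer's `hθE` shape).  `e` = FILE A's Haar functional at the Haar measure of `N(L⁺_v)`.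
[cite: Casselman1995, Lemma 7.1.1 (a) and §6.3] [cite: BernsteinZelevinsky1977, Geometrical Lemma 2.12 and §5 (5.2)] [cite: Rogawski1990, §12.2 p. 173] -/
theorem exists_openCell_linearEquiv_weylTwist (hv : ∀ w : PlacesOver L v, IsCMField.complexConj L • w.1 = w.1)
    (hσ : haveI := locallyCompactSpace_cmBorelU L 3 v
      ∀ w : W, ∃ K : Subgroup ↥(unitaryGroupOfForm (conjLocal L (IsCMField.complexConj L) v) (cmLocalForm L 3 v)), IsOpen (K : Set ↥(unitaryGroupOfForm (conjLocal L (IsCMField.complexConj L) v) (cmLocalForm L 3 v))) ∧ ∀ b : ↥(cmBorelTriple L 3 v).P, (b : ↥(unitaryGroupOfForm (conjLocal L (IsCMField.complexConj L) v) (cmLocalForm L 3 v))) ∈ K → (Representation.twist (σ.comp (cmBorelTriple L 3 v).proj) (rootDeltaChar (cmBorelTriple L 3 v).P)) b w = w)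
    (ℓ : haveI := locallyCompactSpace_cmBorelU L 3 v
      Submodule ℂ ((cmBorelTriple L 3 v).restrict (Representation.normalizedInd (cmBorelTriple L 3 v) σ)).Coinvariants)
    (hℓ : haveI := locallyCompactSpace_cmBorelU L 3 v
      ∀ x, x ∈ ℓ ↔ ∃ f : Representation.SmoothInd (cmBorelTriple L 3 v).P (Representation.twist (σ.comp (cmBorelTriple L 3 v).proj) (rootDeltaChar (cmBorelTriple L 3 v).P)),
        f.toFun 1 = 0 ∧ Representation.Coinvariants.mk ((cmBorelTriple L 3 v).restrict (Representation.normalizedInd (cmBorelTriple L 3 v) σ)) f = x) :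
    haveI := locallyCompactSpace_cmBorelU L 3 v;
    ∃ e : ↥ℓ ≃ₗ[ℂ] W,
      (∀ (m : ↥(cmBorelTriple L 3 v).M) (x : ((cmBorelTriple L 3 v).restrict (Representation.normalizedInd (cmBorelTriple L 3 v) σ)).Coinvariants)
          (hx : x ∈ ℓ) (hmx : (Representation.normalizedInd (cmBorelTriple L 3 v) σ).normalizedJacquet (cmBorelTriple L 3 v) m x ∈ ℓ),
        e ⟨(Representation.normalizedInd (cmBorelTriple L 3 v) σ).normalizedJacquet (cmBorelTriple L 3 v) m x, hmx⟩ =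
          σ ⟨w₀ * (m : ↥(unitaryGroupOfForm (conjLocal L (IsCMField.complexConj L) v) (cmLocalForm L 3 v))) * w₀⁻¹, weylConj_mem_cmTorus L v w₀ hw₀ m⟩ (e ⟨x, hx⟩)) ∧
      (∀ (S : (Representation.normalizedInd (cmBorelTriple L 3 v) σ).IntertwiningMap (Representation.normalizedInd (cmBorelTriple L 3 v) σ))
          (U : W →ₗ[ℂ] W),
          (∀ (F : Representation.SmoothInd (cmBorelTriple L 3 v).P (Representation.twist (σ.comp (cmBorelTriple L 3 v).proj) (rootDeltaChar (cmBorelTriple L 3 v).P))) (g : ↥(unitaryGroupOfForm (conjLocal L (IsCMField.complexConj L) v) (cmLocalForm L 3 v))), (S F).toFun g = U (F.toFun g)) →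
          ∀ (x : ((cmBorelTriple L 3 v).restrict (Representation.normalizedInd (cmBorelTriple L 3 v) σ)).Coinvariants) (hx : x ∈ ℓ)
            (hSx : Representation.jacquetMap (cmBorelTriple L 3 v) S x ∈ ℓ),
            e ⟨Representation.jacquetMap (cmBorelTriple L 3 v) S x, hSx⟩ = U (e ⟨x, hx⟩)) := by
  haveI := locallyCompactSpace_cmBorelU L 3 v
  haveI : LocallyCompactSpace ↥(unitaryGroupOfForm (conjLocal L (IsCMField.complexConj L) v) (cmLocalForm L 3 v)) := locallyCompactSpace_local (IsCMField.complexConj L) 3 _ v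
  haveI : SecondCountableTopology ↥(unitaryGroupOfForm (conjLocal L (IsCMField.complexConj L) v) (cmLocalForm L 3 v)) := secondCountableTopology_local (IsCMField.complexConj L) 3 _ v
  have hNcl : IsClosed ((cmBorelTriple L 3 v).N : Set ↥(unitaryGroupOfForm (conjLocal L (IsCMField.complexConj L) v) (cmLocalForm L 3 v))) :=
    (isClosed_upperUnitriangular (n := 3) (R := LocalRing L v)).preimage continuous_subtype_val
  haveI : LocallyCompactSpace ↥(cmBorelTriple L 3 v).N := hNcl.isClosedEmbedding_subtypeVal.locallyCompactSpace
  haveI : SecondCountableTopology ↥(cmBorelTriple L 3 v).N := TopologicalSpace.Subtype.secondCountableTopology _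
  haveI : CompleteSpace W := FiniteDimensional.complete ℂ W
  borelize ↥(cmBorelTriple L 3 v).N
  have hcs : ∀ f : Representation.SmoothInd (cmBorelTriple L 3 v).P (Representation.twist (σ.comp (cmBorelTriple L 3 v).proj) (rootDeltaChar (cmBorelTriple L 3 v).P)),
      f.toFun 1 = 0 → HasCompactSupport fun n : ↥(cmBorelTriple L 3 v).N => f.toFun (w₀ * (n : ↥(unitaryGroupOfForm (conjLocal L (IsCMField.complexConj L) v) (cmLocalForm L 3 v)))) :=
    fun f hf => hasCompactSupport_cellFun_cmBorel_three L v hv w₀ hw₀ _ f hf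
  have HΛ := exists_openCellFunctional_bijective_cm L v σ w₀ hw₀ hv hσ haar ℓ hℓ
  obtain ⟨Λ, hΛ, hbij⟩ := HΛ
  have happ : ∀ y : ↥ℓ, (LinearEquiv.ofBijective Λ hbij) y = Λ y := fun _ => rfl
  refine ⟨LinearEquiv.ofBijective Λ hbij, fun m x hx hmx => ?_, fun S U hS x hx hSx => ?_⟩
  · exact (happ _).trans ((openCellFunctional_normalizedJacquet_cm L v σ w₀ hw₀ hv haar ℓ hℓ Λ hΛ m x hx hmx).trans
      (congrArg _ (happ ⟨x, hx⟩).symm))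
  · have key := openCellFunctional_jacquetMap_of_pointwise (cmBorelTriple L 3 v) (Representation.twist (σ.comp (cmBorelTriple L 3 v).proj) (rootDeltaChar (cmBorelTriple L 3 v).P)) (Representation.twist (σ.comp (cmBorelTriple L 3 v).proj) (rootDeltaChar (cmBorelTriple L 3 v).P)) haar w₀ ℓ hℓ ℓ hℓ hcs Λ hΛ Λ hΛ S
      (LinearMap.toContinuousLinearMap U) (fun F g => (hS F g).trans rfl) hx hSx
    exact (happ _).trans (key.trans (congrArg U (happ ⟨x, hx⟩).symm))

end CM

/-! ## §3 `dim r_B i_G(σ) = 2 · dim W` -/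

set_option synthInstance.maxHeartbeats 400000 in
set_option maxHeartbeats 6400000 in
/-- **`r_B i_G(σ)` IS FINITE-DIMENSIONAL OF DIMENSION `2 · dim W`** (non-split `v`, any finite-dimensional `σ` on a normed `W` with open vector-fixers):
`dim ℓ = dim W` (§2 at `ℓ :=` ★ (C) `evalJacquetKer`), `r ⧸ ℓ ≅ W` (§1), rank–nullity; the character case `2 = 1 + 1` is ★ N1.
[cite: Casselman1995, Lemma 7.1.1 (a) p. 67] [cite: BernsteinZelevinsky1977, §2.12 Geometrical Lemma, Cor. 2.13 (c)] [cite: Rogawski1990, §12.2 p. 173] -/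
theorem finrank_normalizedJacquet_eq_two_mul (v : HeightOneSpectrum (𝓞 ↥(maximalRealSubfield L)))
    (hv : ∀ w : PlacesOver L v, IsCMField.complexConj L • w.1 = w.1)
    {W : Type*} [NormedAddCommGroup W] [NormedSpace ℂ W] [FiniteDimensional ℂ W]
    (σ : Representation ℂ ↥(cmBorelTriple L 3 v).M W)
    (hσ : haveI := locallyCompactSpace_cmBorelU L 3 v
      ∀ w : W, ∃ K : Subgroup ↥(unitaryGroupOfForm (conjLocal L (IsCMField.complexConj L) v) (cmLocalForm L 3 v)),
        IsOpen (K : Set ↥(unitaryGroupOfForm (conjLocal L (IsCMField.complexConj L) v) (cmLocalForm L 3 v))) ∧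
          ∀ b : ↥(cmBorelTriple L 3 v).P, (b : ↥(unitaryGroupOfForm (conjLocal L (IsCMField.complexConj L) v) (cmLocalForm L 3 v))) ∈ K →
            Representation.twist (σ.comp (cmBorelTriple L 3 v).proj) (rootDeltaChar (cmBorelTriple L 3 v).P) b w = w) :
    haveI := locallyCompactSpace_cmBorelU L 3 v;
    FiniteDimensional ℂ ((cmBorelTriple L 3 v).restrict (Representation.normalizedInd (cmBorelTriple L 3 v) σ)).Coinvariants ∧
      Module.finrank ℂ ((cmBorelTriple L 3 v).restrict (Representation.normalizedInd (cmBorelTriple L 3 v) σ)).Coinvariants =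
        2 * Module.finrank ℂ W := by
  haveI := locallyCompactSpace_cmBorelU L 3 v
  have HW := F0P3U3PrincipalSeriesOpenCellTorusChar.exists_weylElt_three L v hv
  obtain ⟨w₀, hw₀⟩ := HW
  have hδ := F0P2nBorelCharactersUnipotent.deltaChar_cmBorel_eq_one L v
  have hℓ := F0P3U3PrincipalSeriesJacquetClosedCell.mem_evalJacquetKer_iff (cmBorelTriple L 3 v) σ hδ
  have HE := exists_openCell_linearEquiv_weylTwist L v σ w₀ hw₀ hv hσ
    (F0P3U3PrincipalSeriesJacquetClosedCell.evalJacquetKer (cmBorelTriple L 3 v) σ hδ) hℓ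
  obtain ⟨e, -, -⟩ := HE
  haveI hfinℓ : FiniteDimensional ℂ ↥(F0P3U3PrincipalSeriesJacquetClosedCell.evalJacquetKer (cmBorelTriple L 3 v) σ hδ) :=
    LinearEquiv.finiteDimensional e.symm
  have hℓW := e.finrank_eq
  have hsurj := evalJacquet_surjective (cmBorelTriple L 3 v) σ hδ hσ
  have htop : LinearMap.range (F0P3U3PrincipalSeriesJacquetClosedCell.evalJacquet (cmBorelTriple L 3 v) σ hδ).toLinearMap = ⊤ :=
    LinearMap.range_eq_top.2 hsurj
  have eq : (((cmBorelTriple L 3 v).restrict (Representation.normalizedInd (cmBorelTriple L 3 v) σ)).Coinvariants ⧸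
      F0P3U3PrincipalSeriesJacquetClosedCell.evalJacquetKer (cmBorelTriple L 3 v) σ hδ) ≃ₗ[ℂ] W :=
    (F0P3U3PrincipalSeriesJacquetClosedCell.evalJacquet (cmBorelTriple L 3 v) σ hδ).toLinearMap.quotKerEquivRange.trans (LinearEquiv.ofTop _ htop)
  haveI hfinq : FiniteDimensional ℂ (((cmBorelTriple L 3 v).restrict (Representation.normalizedInd (cmBorelTriple L 3 v) σ)).Coinvariants ⧸
      F0P3U3PrincipalSeriesJacquetClosedCell.evalJacquetKer (cmBorelTriple L 3 v) σ hδ) :=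
    LinearEquiv.finiteDimensional eq.symm
  have hqW := eq.finrank_eq
  haveI hfd : FiniteDimensional ℂ ((cmBorelTriple L 3 v).restrict (Representation.normalizedInd (cmBorelTriple L 3 v) σ)).Coinvariants :=
    Module.Finite.of_exact
      (LinearMap.exact_subtype_mkQ (F0P3U3PrincipalSeriesJacquetClosedCell.evalJacquetKer (cmBorelTriple L 3 v) σ hδ))
      (Submodule.mkQ_surjective _)
  have hsum := Submodule.finrank_quotient_add_finrank (F0P3U3PrincipalSeriesJacquetClosedCell.evalJacquetKer (cmBorelTriple L 3 v) σ hδ)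
  exact ⟨hfd, by omega⟩

end Summit.HodgeConjecture.HodgeConjecture.Cruxes.H413.F0P3U3PrincipalSeriesOpenCellSigmaTwist

end
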